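import Literature.NumberTheory.EllipticCurves.SelmerInftyTorsionPowKummerLiftProofs
import Literature.NumberTheory.EllipticCurves.IwasawaTwistModPk
import Literature.NumberTheory.EllipticCurves.IwasawaTwistModPDual
import Literature.NumberTheory.EllipticCurves.IwasawaTowerTorsionProofs
import HarnessLib

/-!
# Crux `KatoDivisibilityX9` (stmt-BirchSwinnertonDyer-20547), line `graded_euler_loss`, stub
# `stub_testCocyclePkLevelX9` (g5 wave 2), part 3: the Kummer bridge `H¹(H, E[p^k]) → H¹(H, E[p^∞])`
# in the spelling `E[p^k] = geomTorsion W ((p : ℤ) ^ k)`, and the dictionary hypotheses for the twists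

Seat `bsd-line-k6-p4` (prover-bsd-line-k6-p4-g5-0, stub worker A).  THEOREMS ONLY (no definition, no
named fact, no `sorry`); `--supports stmt-BirchSwinnertonDyer-20547` helper; closes nothing.

§1–§2.  For a Weierstrass curve `W` over a field `K`, a prime `p`, `k : ℕ` and a subgroup `H ≤ Γ_K`,
the map `ι_k : H¹(H, E[p^k]) → H¹(H, E[p^∞])` is `resH1Hom id (E[p^k] ↪ E[p^∞])`, written inline (the
tree's `torsionToPrimaryH1Sub` is `k = 1` in the spelling `(p : ℤ)`, its `exists_torsionPowToPrimaryH1Sub_eq`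
uses `((p ^ J : ℕ) : ℤ)`; the level-`p^k` twists `modPkTwist` use `(p : ℤ) ^ k`, hence this file):
* `pkTorsion_le_geomPrimaryTorsion` — `E[p^k] ≤ E[p^∞]`;
* `exists_resH1Hom_pkTorsion_eq` — Kummer lift: every `p^k`-torsion class of `H¹(H, E[p^∞])` comes from
  `H¹(H, E[p^k])` (`E[p^∞]` divisible);
* `resH1Hom_pkTorsion_injective_of_fixed` — `ι_k` is injective once `E[p^∞]^H` has no `p`-torsion;
* `conjH1_resH1Hom_pkTorsion`, `iterate_conjH1_sub_resH1Hom_pkTorsion` — naturality w.r.t. `conj_σ`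
  and `(conj_γ − id)^[m]`;
* `resH1Hom_pkTorsion_oneCocycleClass_eq_of_coe_eq` — two cocycles with the same values in `E(K̄)`
  (one in `E[p^k]`, one in `E[p]`) have the same image in `H¹(H, E[p^∞])`;
* `oneCocycleClass_nsmul_eq_resH1Hom_of_coe_eq` — `p^d [c] = ι_k`-compatible reading of `p^d`.
§3.  The hypotheses (hX)/(hγ) of the inflation–restriction dictionary (`…StubTestCocyclePkLevelX9InfRes`)
for `X = W.modPkTwist p k κ.invTwist L` and `X = W.modPTwist p κ.invTwist L`: `Γ_∞ = ker κ` acts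
coordinatewise, and a topological generator `γ` of `κ` acts by `(1+S)^{-1}` after the coordinatewise
action (`κ⁻¹(γ) = −1`, `(1+S)^{p^N} = 1`).

References: R. Greenberg, LNM 1716 (1999) §3 p. 73, §5 p. 114 [GreenbergLNM1716]; J. H. Silverman,
*AEC* VIII §2, X §4 [SilvermanAEC2009]; L. Washington (1997) §13.1–13.2 [Washington1997]; B. Mazur,
K. Rubin, Mem. AMS 799 (2004) §5.3 [MazurRubin2004].
-/

set_option autoImplicit false
-- the summit and its single problem are both named `BirchSwinnertonDyer` (registry layout D-0017)
set_option linter.dupNamespace false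

noncomputable section

open scoped ContRepresentation
open Field Literature.NumberTheory.GaloisRepresentations Literature.NumberTheory.EllipticCurves
open WeierstrassCurve (geomTorsion geomPrimaryTorsion geomPoints)

universe u

namespace Summit.BirchSwinnertonDyer.BirchSwinnertonDyer.Theorems.OneSidedTwistSqueezeX9KatoDivisibilityX9StubTestCocyclePkLevelX9Kummer

/-! ## §1 `E[p^k] ≤ E[p^∞]` and the Kummer lift at level `p^k` -/

section Kummer

variable {K : Type u} [Field K] (W : WeierstrassCurve K) (p k : ℕ)
  (H : Subgroup (absoluteGaloisGroup K))

/-- `E[p^k] ⊆ E[p^∞]` in the spelling `geomTorsion W ((p : ℤ) ^ k)`. [cite: SilvermanAEC2009, III.§4 (Definition of E[m])] -/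
theorem pkTorsion_le_geomPrimaryTorsion : geomTorsion W ((p : ℤ) ^ k) ≤ geomPrimaryTorsion W p :=
  fun P hP => ⟨k, by
    have h := W.pow_nsmul_geomTorsion_eq_zero p k ⟨P, hP⟩
    exact congrArg Subtype.val h⟩

variable [Fact p.Prime]

/-- **Kummer lift at level `p^k`: `H¹(H, E[p^k]) ↠ H¹(H, E[p^∞])[p^k]`** (spelling `(p : ℤ) ^ k`).  If
`p^k x = 0` then a cocycle `φ` of `x` has `p^k φ = ∂a`, `a = p^k b` (`E[p^∞]` divisible), and `φ − ∂b` is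
valued in `E[p^k]`.  Port of the tree's `exists_torsionPowToPrimaryH1Sub_eq`.
[cite: GreenbergLNM1716, §5 p. 114] -/
theorem exists_resH1Hom_pkTorsion_eq (hdiv : W.zsmul_geomPoints_surjective) [W.IsElliptic]
    {x : W.subgroupH1 p H} (hx : p ^ k • x = 0) :
    ∃ y : Literature.NumberTheory.EllipticCurves.subgroupH1 H (geomTorsion W ((p : ℤ) ^ k)),
      resH1Hom (ContinuousMonoidHom.id H)
        (AddSubgroup.inclusion (pkTorsion_le_geomPrimaryTorsion W p k)) (fun _ _ => rfl) y = x := by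
  obtain ⟨φ, rfl⟩ := oneCocycleClass_surjective _ x
  have h := oneCocycleClass_smul (discreteTopRep H (geomPrimaryTorsion W p)) ((p ^ k : ℕ) : ℤ) φ
  conv at h => rhs; rw [Nat.cast_smul_eq_nsmul, hx]
  obtain ⟨a, ha⟩ := (oneCocycleClass_eq_zero_iff _ _).mp h
  have ha' : ∀ σ : H, p ^ k • φ.1 σ = σ • a - a := fun σ => by
    rw [← natCast_zsmul, Nat.cast_pow]
    have := ha σ
    rwa [Nat.cast_pow] at this
  obtain ⟨b, rfl⟩ :=
    Literature.Barriers.BirchSwinnertonDyer.exists_pow_nsmul_eq_geomPrimaryTorsion W p k hdiv a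
  set φ' := φ - cobCocycle b (W.continuous_smul_geomPrimaryTorsion_sub p b) with hφ'
  have hval : ∀ σ : H, p ^ k • φ'.1 σ = 0 := fun σ => by
    change p ^ k • (φ.1 σ - (σ • b - b)) = 0
    rw [smul_sub, ha', smul_sub, smul_comm, sub_self]
  have hmem : ∀ σ : H,
      ((φ'.1 σ : geomPrimaryTorsion W p) : geomPoints W) ∈ geomTorsion W ((p : ℤ) ^ k) := fun σ => by
    change ((p : ℤ) ^ k) • ((φ'.1 σ : geomPrimaryTorsion W p) : geomPoints W) = 0
    rw [← Nat.cast_pow, natCast_zsmul, ← AddSubgroupClass.coe_nsmul, hval σ, ZeroMemClass.coe_zero]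
  let χ : contOneCocycles (discreteTopRep H (geomTorsion W ((p : ℤ) ^ k))) :=
    contOneCocycles.lift (AddSubgroup.inclusion (pkTorsion_le_geomPrimaryTorsion W p k))
      (fun _ _ => rfl) (AddSubgroup.inclusion_injective _) φ' (fun σ => ⟨_, hmem σ⟩) (fun _ => rfl)
  refine ⟨oneCocycleClass _ χ, ?_⟩
  rw [resH1Hom_id_oneCocycleClass, contOneCocycles.push_lift, hφ', oneCocycleClass_sub,
    oneCocycleClass_cobCocycle, sub_zero]

omit [Fact p.Prime] in
/-- **`ι_k : H¹(H, E[p^k]) → H¹(H, E[p^∞])` is injective when `E[p^∞]^H` has no `p`-torsion.**  If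
`ι ∘ z = ∂Q` then `p^k Q` is `H`-fixed; an `H`-fixed element of the `p`-primary `E[p^∞]` vanishes
(otherwise a multiple of it is a non-zero `H`-fixed `p`-torsion element), so `Q ∈ E[p^k]` and `z = ∂Q`.
[cite: GreenbergLNM1716, §3 p. 73 and §5 p. 114] -/
theorem resH1Hom_pkTorsion_injective_of_fixed
    (hH : ∀ m : geomPrimaryTorsion W p, (∀ σ ∈ H, σ • m = m) → p • m = 0 → m = 0) :
    Function.Injective (resH1Hom (ContinuousMonoidHom.id H)
      (AddSubgroup.inclusion (pkTorsion_le_geomPrimaryTorsion W p k)) (fun _ _ => rfl)) := by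
  have hfix : ∀ m : geomPrimaryTorsion W p, (∀ σ ∈ H, σ • m = m) → m = 0 := by
    intro m hm
    by_contra h0
    obtain ⟨j, hne, hpj⟩ := W.exists_pow_smul_ne_zero_and_p_smul_eq_zero h0
    exact hne (hH _ (fun σ hσ => by rw [smul_comm, hm σ hσ]) hpj)
  rw [injective_iff_map_eq_zero]
  intro y hy
  obtain ⟨z, rfl⟩ := oneCocycleClass_surjective _ y
  rw [resH1Hom_id_oneCocycleClass, oneCocycleClass_eq_zero_iff] at hy
  obtain ⟨Q, hQ⟩ := hy
  have hQ' : ∀ σ : H, AddSubgroup.inclusion (pkTorsion_le_geomPrimaryTorsion W p k) (z.1 σ) =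
      (σ : absoluteGaloisGroup K) • Q - Q := fun σ => hQ σ
  have hval : ∀ σ : H, p ^ k • z.1 σ = 0 := fun σ => W.pow_nsmul_geomTorsion_eq_zero p k (z.1 σ)
  have hfixQ : ∀ σ ∈ H, σ • (p ^ k • Q) = p ^ k • Q := fun σ hσ => by
    rw [← sub_eq_zero, smul_comm, ← smul_sub, ← hQ' ⟨σ, hσ⟩, ← map_nsmul, hval, map_zero]
  have hQ0 : p ^ k • Q = 0 := hfix _ hfixQ
  have hmem : ((Q : geomPrimaryTorsion W p) : geomPoints W) ∈ geomTorsion W ((p : ℤ) ^ k) := by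
    change ((p : ℤ) ^ k) • ((Q : geomPrimaryTorsion W p) : geomPoints W) = 0
    rw [← Nat.cast_pow, natCast_zsmul, ← AddSubgroupClass.coe_nsmul, hQ0, ZeroMemClass.coe_zero]
  refine (oneCocycleClass_eq_zero_iff _ z).mpr ⟨⟨_, hmem⟩, fun σ => ?_⟩
  apply AddSubgroup.inclusion_injective (pkTorsion_le_geomPrimaryTorsion W p k)
  rw [hQ', map_sub]
  rfl

omit [Fact p.Prime] in
/-- `ι_k` commutes with the conjugation action: `conj_σ (ι_k y) = ι_k (conj_σ y)` (functoriality of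
`H¹` in compatible pairs). [cite: NeukirchSchmidtWingberg2008, I.§5] -/
theorem conjH1_resH1Hom_pkTorsion [H.Normal] (σ : absoluteGaloisGroup K)
    (y : Literature.NumberTheory.EllipticCurves.subgroupH1 H (geomTorsion W ((p : ℤ) ^ k))) :
    W.conjH1 p H σ (resH1Hom (ContinuousMonoidHom.id H)
        (AddSubgroup.inclusion (pkTorsion_le_geomPrimaryTorsion W p k)) (fun _ _ => rfl) y) =
      resH1Hom (ContinuousMonoidHom.id H)
        (AddSubgroup.inclusion (pkTorsion_le_geomPrimaryTorsion W p k)) (fun _ _ => rfl)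
        (Literature.NumberTheory.EllipticCurves.conjH1 H (geomTorsion W ((p : ℤ) ^ k)) σ y) := by
  change ((W.conjH1 p H σ).comp (resH1Hom (ContinuousMonoidHom.id H)
      (AddSubgroup.inclusion (pkTorsion_le_geomPrimaryTorsion W p k)) (fun _ _ => rfl))) y =
    ((resH1Hom (ContinuousMonoidHom.id H)
      (AddSubgroup.inclusion (pkTorsion_le_geomPrimaryTorsion W p k)) (fun _ _ => rfl)).comp
      (Literature.NumberTheory.EllipticCurves.conjH1 H (geomTorsion W ((p : ℤ) ^ k)) σ)) y
  rw [WeierstrassCurve.conjH1, Literature.NumberTheory.EllipticCurves.conjH1,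
    Literature.NumberTheory.EllipticCurves.conjH1, resH1Hom_comp, resH1Hom_comp]
  exact congrArg (fun f : Literature.NumberTheory.EllipticCurves.subgroupH1 H
      (geomTorsion W ((p : ℤ) ^ k)) →+ W.subgroupH1 p H => f y)
    (resH1Hom_congr (ContinuousMonoidHom.ext fun _ => rfl) (AddMonoidHom.ext fun _ => rfl) _ _)

omit [Fact p.Prime] in
/-- `ι_k` commutes with the iterates of `conj_γ − id`. [cite: NeukirchSchmidtWingberg2008, I.§5] -/
theorem iterate_conjH1_sub_resH1Hom_pkTorsion [H.Normal] (γ : absoluteGaloisGroup K) (m : ℕ)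
    (y : Literature.NumberTheory.EllipticCurves.subgroupH1 H (geomTorsion W ((p : ℤ) ^ k))) :
    (⇑(W.conjH1 p H γ - AddMonoidHom.id (W.subgroupH1 p H)))^[m]
        (resH1Hom (ContinuousMonoidHom.id H)
          (AddSubgroup.inclusion (pkTorsion_le_geomPrimaryTorsion W p k)) (fun _ _ => rfl) y) =
      resH1Hom (ContinuousMonoidHom.id H)
        (AddSubgroup.inclusion (pkTorsion_le_geomPrimaryTorsion W p k)) (fun _ _ => rfl)
        ((⇑(Literature.NumberTheory.EllipticCurves.conjH1 H (geomTorsion W ((p : ℤ) ^ k)) γ -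
          AddMonoidHom.id (Literature.NumberTheory.EllipticCurves.subgroupH1 H
            (geomTorsion W ((p : ℤ) ^ k)))))^[m] y) := by
  induction m generalizing y with
  | zero => rfl
  | succ m ih =>
    rw [Function.iterate_succ_apply', Function.iterate_succ_apply', ih, AddMonoidHom.sub_apply,
      AddMonoidHom.sub_apply, AddMonoidHom.id_apply, AddMonoidHom.id_apply, map_sub,
      conjH1_resH1Hom_pkTorsion]

omit [Fact p.Prime] in
/-- **Two cocycles with the same values in `E(K̄)` have the same image in `H¹(H, E[p^∞])`** — one valued
in `E[p^k]` (read through `ι_k`), one in `E[p]` (read through `torsionToPrimaryH1Sub`); e.g. `ι ∘ c₁` for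
an equivariant `ι : E[p] → E[p^k]` inducing the inclusion of points. [cite: GreenbergLNM1716, §5 p. 114] -/
theorem resH1Hom_pkTorsion_oneCocycleClass_eq_of_coe_eq
    (c : contOneCocycles (discreteTopRep H (geomTorsion W ((p : ℤ) ^ k))))
    (c₁ : contOneCocycles (discreteTopRep H (geomTorsion W (p : ℤ))))
    (h : ∀ τ : H, ((c.1 τ : geomTorsion W ((p : ℤ) ^ k)) : geomPoints W) = (c₁.1 τ : geomPoints W)) :
    resH1Hom (ContinuousMonoidHom.id H)
        (AddSubgroup.inclusion (pkTorsion_le_geomPrimaryTorsion W p k)) (fun _ _ => rfl)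
        (oneCocycleClass _ c) =
      W.torsionToPrimaryH1Sub p H (oneCocycleClass _ c₁) := by
  rw [resH1Hom_id_oneCocycleClass, W.torsionToPrimaryH1Sub_oneCocycleClass]
  congr 1
  refine Subtype.ext (ContinuousMap.ext fun τ => ?_)
  rw [contOneCocycles.push_apply, contOneCocycles.push_apply]
  exact Subtype.ext (h τ)

omit [Fact p.Prime] in
/-- Multiples: `n • [c]` read through `ι_k` is the class of the cocycle `n • c`, whose values in `E(K̄)`
are `n • c(τ)`; hence if `n • c(τ) = c₁(τ)` in `E(K̄)` for a cocycle `c₁` valued in `E[p]` then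
`n • ι_k [c] = torsionToPrimaryH1Sub [c₁]`. [cite: GreenbergLNM1716, §5 p. 114] -/
theorem nsmul_resH1Hom_pkTorsion_eq_of_coe_eq (n : ℕ)
    (c : contOneCocycles (discreteTopRep H (geomTorsion W ((p : ℤ) ^ k))))
    (c₁ : contOneCocycles (discreteTopRep H (geomTorsion W (p : ℤ))))
    (h : ∀ τ : H, n • ((c.1 τ : geomTorsion W ((p : ℤ) ^ k)) : geomPoints W) = (c₁.1 τ : geomPoints W)) :
    n • resH1Hom (ContinuousMonoidHom.id H)
        (AddSubgroup.inclusion (pkTorsion_le_geomPrimaryTorsion W p k)) (fun _ _ => rfl)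
        (oneCocycleClass _ c) =
      W.torsionToPrimaryH1Sub p H (oneCocycleClass _ c₁) := by
  rw [← map_nsmul]
  have hn : n • oneCocycleClass (discreteTopRep H (geomTorsion W ((p : ℤ) ^ k))) c =
      oneCocycleClass _ ((n : ℤ) • c) := by
    rw [oneCocycleClass_smul, Nat.cast_smul_eq_nsmul]
  rw [hn]
  refine resH1Hom_pkTorsion_oneCocycleClass_eq_of_coe_eq W p k H _ c₁ fun τ => ?_
  rw [← h τ]
  change (((n : ℤ) • c.1 τ : geomTorsion W ((p : ℤ) ^ k)) : geomPoints W) = _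
  rw [natCast_zsmul, AddSubgroupClass.coe_nsmul]

end Kummer

/-! ## §3 The dictionary hypotheses for `X = 𝒯_L^{(k)}(E, κ⁻¹)` and `X = 𝒯_L(E[p], κ⁻¹)` -/

section Twist

variable {K : Type u} [Field K] (W : WeierstrassCurve K) (p : ℕ) [Fact p.Prime] (k : ℕ)
  (κ : ZpExtension K p) (L : ℕ)

/-- (hX) for `X = W.modPkTwist p k κ.invTwist L`: `Γ_∞ = ker κ` acts coordinatewise (`ker κ = ker κ⁻¹ ≤
Gal(K̄/K_{L+k})`, `(1+T)^{p^{L+k}} = 1` in `(ℤ/p^k)[T]/(T^L)`). [cite: Washington1997, §13.1–§13.2] -/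
theorem modPkTwist_invTwist_apply_of_mem_kerSubgroup {τ : absoluteGaloisGroup K} (hτ : τ ∈ κ.kerSubgroup)
    (x : Fin L → geomTorsion W ((p : ℤ) ^ k)) :
    W.modPkTwist p k κ.invTwist L τ x = fun i => τ • x i := by
  have hτ' : τ ∈ κ.invTwist.layerSubgroup (L + k) := by
    rw [ZpExtension.layerSubgroup_invTwist]
    exact κ.kerSubgroup_le_layerSubgroup (L + k) hτ
  exact W.modPkTwist_apply_of_mem_layerSubgroup p k κ.invTwist L (m := L + k)
    ((Nat.lt_pow_self (Fact.out : p.Prime).one_lt).le.trans (Nat.pow_le_pow_right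
      (Fact.out : p.Prime).pos (by omega))) hτ' x

/-- The twist exponent of `κ⁻¹` at a topological generator `γ` of `κ` is `≡ −1`:
`p^N ∣ twistExponent κ⁻¹ N γ + 1`. [cite: Washington1997, §13.1–§13.2] -/
theorem prime_pow_dvd_twistExponent_invTwist_add_one {γ : absoluteGaloisGroup K} (hγ : κ.IsTopGenerator γ)
    (N : ℕ) : p ^ N ∣ κ.invTwist.twistExponent N γ + 1 := by
  rw [← ZMod.natCast_eq_zero_iff, Nat.cast_add, ZpExtension.twistExponent, ZMod.natCast_zmod_val,
    ZpExtension.toAdd_invTwist_apply, map_neg, show (κ γ).toAdd = 1 by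
      rw [show κ γ = Multiplicative.ofAdd 1 from hγ, toAdd_ofAdd], map_one, Nat.cast_one,
    neg_add_cancel]

/-- (hγ) for `X = W.modPkTwist p k κ.invTwist L`: a topological generator `γ` of `κ` acts by `(1+S)^{-1}`
after the coordinatewise action, i.e. `X γ x + S (X γ x) = (γ • x_i)_i` (`κ⁻¹(γ) = −1` and
`(1+S)^{p^{L+k}} = 1`). [cite: Washington1997, §13.1–§13.2] -/
theorem modPkTwist_invTwist_add_shiftEnd_of_isTopGenerator {γ : absoluteGaloisGroup K}
    (hγ : κ.IsTopGenerator γ) (x : Fin L → geomTorsion W ((p : ℤ) ^ k)) :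
    W.modPkTwist p k κ.invTwist L γ x + shiftEnd (geomTorsion W ((p : ℤ) ^ k)) L
        (W.modPkTwist p k κ.invTwist L γ x) = fun i => γ • x i := by
  rw [W.modPkTwist_apply, ← ZpExtension.unipotentPow_succ_apply,
    unipotentPow_eq_one_of_dvd_of_pow_smul (W.pow_nsmul_geomTorsion_eq_zero p k) (m := L + k)
      ((Nat.lt_pow_self (Fact.out : p.Prime).one_lt).le.trans
        (Nat.pow_le_pow_right (Fact.out : p.Prime).pos (by omega)))
      (prime_pow_dvd_twistExponent_invTwist_add_one p κ hγ (L + k)),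
    Module.End.one_apply]

/-- (hX) for `X = W.modPTwist p κ.invTwist L` (the mod-`p` model): `Γ_∞` acts coordinatewise.
[cite: Washington1997, §13.1–§13.2] -/
theorem modPTwist_invTwist_apply_of_mem_kerSubgroup {τ : absoluteGaloisGroup K} (hτ : τ ∈ κ.kerSubgroup)
    (x : Fin L → geomTorsion W (p : ℤ)) :
    W.modPTwist p κ.invTwist L τ x = fun i => τ • x i := by
  have hτ' : τ ∈ κ.invTwist.layerSubgroup L := by
    rw [ZpExtension.layerSubgroup_invTwist]
    exact κ.kerSubgroup_le_layerSubgroup L hτ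
  exact W.modPTwist_apply_of_mem_layerSubgroup p κ.invTwist L le_rfl
    (Nat.lt_pow_self (Fact.out : p.Prime).one_lt).le hτ' x

/-- (hγ) for `X = W.modPTwist p κ.invTwist L`: `X γ x + S (X γ x) = (γ • x_i)_i` for a topological
generator `γ` of `κ`. [cite: Washington1997, §13.1–§13.2] -/
theorem modPTwist_invTwist_add_shiftEnd_of_isTopGenerator {γ : absoluteGaloisGroup K}
    (hγ : κ.IsTopGenerator γ) (x : Fin L → geomTorsion W (p : ℤ)) :
    W.modPTwist p κ.invTwist L γ x + shiftEnd (geomTorsion W (p : ℤ)) L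
        (W.modPTwist p κ.invTwist L γ x) = fun i => γ • x i := by
  rw [W.modPTwist_apply, ← ZpExtension.unipotentPow_succ_apply,
    unipotentPow_eq_one_of_dvd (fun P : geomTorsion W (p : ℤ) => AddSubgroup.torsionBy.nsmul P) (m := L)
      (Nat.lt_pow_self (Fact.out : p.Prime).one_lt).le
      (prime_pow_dvd_twistExponent_invTwist_add_one p κ hγ L),
    Module.End.one_apply]

end Twist

end Summit.BirchSwinnertonDyer.BirchSwinnertonDyer.Theorems.OneSidedTwistSqueezeX9KatoDivisibilityX9StubTestCocyclePkLevelX9Kummer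

end
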